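import Literature.Computability.FineGrained.SchoeningAlgorithm
import Literature.Computability.FineGrained.LightSatProg
import Literature.Computability.Complexity.StackStrings
import HarnessLib

/-!
# Schöning's random walk for k-SAT, III: the stack machine — codes and the assignment pass

Topic `Literature/Computability/FineGrained`, sequel of `SchoeningAlgorithm.lean`. The
algorithm `runCoins` is programmed as a structured stack program (`Com`,
`StackPrograms.lean`, compiled to Mathlib's `Turing.FinTM2` by `StackMachinesTM2.lean`) over
the 28 named binary registers `LightSearch.R` of `LightSatProg.lean`, whose register-file
bookkeeping (`RF`, `mk`), token machinery (`Tok`, `bits`, `emit`, `tokCase`, `tokLoop`,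
`Handlers`) and flag idiom (`setFlag`) we reuse; the register *names* are LightSat's, their
roles here are:

* `w` input, `w2` the coins (top = next coin), `f` the formula code (`fr` its reversed
  re-emission buffer), `f2` the assignment code (`f2r` likewise), `x` the query variable
  (`xc` its working copy, `xr` a reversed collecting buffer), `t`, `u` scratch of `copy`,
  `lb` the reversed buffer of the clause being scanned, `cb` the first violated clause,
  `o` the answer flag, `pb`, `mis`, `sat`, `ls`, `he`, `md`, `hd`, `cc` flags, `bu` the step
  counter, `uu` the selected position (unary), `f3`, `f3r`, `tt` parser scratch, `out` output.

This file: the token codes of literals / assignment entries / clauses / formulas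
(`eToks`, `aToks`, `cToks`, `fToks`: a literal or entry `(y, v)` is its index bits
`bit y₀ … bit y_{m-1}` closed by `pol v`; a clause is its literals closed by `endc`). This is
deliberately NOT LightSat's `litToks` (`LightSatSplitting.lean`: `pol b :: bits ++ [endl]`, for
which the reused `Tok`/`bits` machinery was designed): here the polarity/value token `pol`
*closes* the entry, doubling as its end marker — one `endl` less per entry, and, more to the
point, the order in which the machine input `encodeBool φ` presents a literal (index first,
polarity last) and in which the bit-by-bit index comparison wants to read an entry (bits, then
the decision at the value). Then
**the assignment pass** `lookup m` over `f2` in three modes — `has` (is the variable `x`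
assigned?), `val` (its value), `flip` (negate it) — comparing every entry's index with `x`
bit by bit (`cmpMis`), with its exact functional effect (`runs_lookup`: the pass realises
`hasKey` / `valOf` / `flipKey` of `SchoeningAlgorithm.lean` on codes) and a linear cost bound.

## References

* U. Schöning, FOCS 1999 (the algorithm). [SchoeningFOCS1999]
* T. Nipkow, G. Klein, *Concrete Semantics with Isabelle/HOL*, Springer 2014, Ch. 7 (big-step
  reasoning about structured programs; the verification style of the `Stack*.lean` toolkit).
-/

namespace Literature.Computability.FineGrained.Schoening

open Complexity Complexity.Com LightSearch _root_.Computability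

/-! ### Token codes -/

/-- The tokens of a literal / assignment entry `(y, v)`: the index bits, closed by `pol v`.
[folklore] -/
def eToks (e : List Bool × Bool) : List Tok := e.1.map Tok.bit ++ [Tok.pol e.2]

/-- The tokens of an assignment (or of the literals of a clause). [folklore] -/
def aToks (al : List (List Bool × Bool)) : List Tok := al.flatMap eToks

/-- The tokens of a clause: its literals, closed by `endc`. [folklore] -/
def cToks (c : Clause (List Bool)) : List Tok := aToks c ++ [Tok.endc]

/-- The tokens of a clause list. [folklore] -/
def fToks (F : CNF (List Bool)) : List Tok := F.flatMap cToks

/-- `aToks` of a cons. [folklore] -/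
@[simp] theorem aToks_cons (e : List Bool × Bool) (al : List (List Bool × Bool)) :
    aToks (e :: al) = eToks e ++ aToks al := by simp [aToks]

/-- `aToks` of the empty list. [folklore] -/
@[simp] theorem aToks_nil : aToks [] = [] := rfl

/-- `aToks` of a concatenation. [folklore] -/
@[simp] theorem aToks_append (a b : List (List Bool × Bool)) : aToks (a ++ b) = aToks a ++ aToks b := by
  simp [aToks]

/-- `fToks` of a cons. [folklore] -/
@[simp] theorem fToks_cons (c : Clause (List Bool)) (F : CNF (List Bool)) :
    fToks (c :: F) = cToks c ++ fToks F := by simp [fToks]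

/-- `fToks` of the empty formula. [folklore] -/
@[simp] theorem fToks_nil : fToks [] = [] := rfl

/-- The bit code of index tokens. [folklore] -/
theorem bits_map_bit (y : List Bool) : bits (y.map Tok.bit) = y.flatMap fun b => [true, b] := by
  induction y with
  | nil => rfl
  | cons b y ih => simp [ih, Tok.code]

/-- Length of the code of index bits. [folklore] -/
@[simp] theorem length_bits_map_bit (y : List Bool) : (bits (y.map Tok.bit)).length = 2 * y.length := by
  rw [bits_map_bit, List.length_flatMap]; simp; omega

/-- Length of the code of an entry. [folklore] -/
@[simp] theorem length_bits_eToks (e : List Bool × Bool) : (bits (eToks e)).length = 2 * e.1.length + 3 := by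
  simp [eToks, Tok.code]

/-- Length of the code of an assignment. [folklore] -/
theorem length_bits_aToks (al : List (List Bool × Bool)) :
    (bits (aToks al)).length = (al.map fun e => 2 * e.1.length + 3).sum := by
  induction al with
  | nil => rfl
  | cons e al ih => simp [ih]

/-! ### Flags popped destructively -/

/-- `popFlag F c₁ c₂`: pop the flag register `F`; run `c₁` if it held `true`, `c₂` if it was
empty — the *destructive* variant of `Com.ifFlag` of `StackStrings.lean` (which re-pushes the
flag before running `c₁`); flags here are single-use, so consuming them saves the reset.
[folklore] -/
def popFlag (F : R) (c₁ c₂ : Com R) : Com R := .pop F c₁ c₂ c₂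

/-- `popFlag` follows the flag, within the cost of the branch plus `2`. [folklore] -/
theorem runs_popFlag {F : R} {c₁ c₂ : Com R} {b : Bool} {Rg R' : Regs R} {B : ℕ}
    (hF : Rg F = flag b) (h₁ : b = true → Runs c₁ (Function.update Rg F []) R' B)
    (h₂ : b = false → Runs c₂ Rg R' B) : Runs (popFlag F c₁ c₂) Rg R' (B + 2) := by
  cases b with
  | true => exact Runs.pop_true _ _ (w := []) (by simpa using hF) (h₁ rfl)
  | false => exact Runs.pop_nil _ _ (by simpa using hF) (h₂ rfl)

/-! ### The assignment pass: comparing indices with the query -/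

/-- The three modes of the assignment pass. [folklore] -/
inductive LMode
  | has
  | val
  | flip
  deriving DecidableEq

/-- Compare the bit `b` of the current entry with the next bit of the query copy `xc`: a
difference, or an exhausted `xc`, raises `mis`. [folklore] -/
def cmpBit (b : Bool) : Com R :=
  .pop .xc (if b then .skip else setFlag .mis) (if b then setFlag .mis else .skip) (setFlag .mis)

/-- Handler of an index bit: copy it to `f2r`; at the start of an entry (`md` down) reload the
query into `xc` and raise `md`; compare. [folklore] -/
def luBit (b : Bool) : Com R :=
  emit .f2r (.bit b) ;; .pop .md (.push .md true) (.push .md true) (copy .x .xc .t .u ;; .push .md true) ;;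
    cmpBit b

/-- What a matching entry with value `v` does, by mode: `has` raises `ls`, `val` raises `ls`
iff `v`, `flip` emits the entry with `v` negated. [folklore] -/
def onMatch : LMode → Bool → Com R
  | .has, v => emit .f2r (.pol v) ;; setFlag .ls
  | .val, v => emit .f2r (.pol v) ;; (if v then setFlag .ls else .skip)
  | .flip, v => emit .f2r (.pol (!v))

/-- Handler of the end of an entry (`pol v`): at an entry without bits load the query now
(`md` is consumed either way); the entry matches iff no mismatch was seen and `xc` is
exhausted; dispatch. [folklore] -/
def luPol (m : LMode) (v : Bool) : Com R :=
  .pop .md .skip .skip (copy .x .xc .t .u) ;;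
  .pop .xc (setFlag .mis ;; clear .xc) (setFlag .mis ;; clear .xc) .skip ;;
  .pop .mis (emit .f2r (.pol v)) (emit .f2r (.pol v)) (onMatch m v)

/-- The handlers of the assignment pass. [folklore] -/
def luH (m : LMode) : Handlers := ⟨luBit, luPol m, .skip, .skip, .skip, .skip, .skip⟩

/-- The handlers by token. [folklore] -/
theorem luH_run (m : LMode) (t : Tok) : (luH m).run t =
    (match t with
      | .bit b => luBit b
      | .pol v => luPol m v
      | _ => .skip) := by
  cases t <;> rfl

/-- **The assignment pass**: the token loop over `f2`, then pour the re-emitted entries back.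
[folklore] -/
def lookup (m : LMode) : Com R := tokLoop .f2 (luH m) ;; pour .f2r .f2

/-! ### Functional model of the comparison -/

/-- The mismatch flag after comparing the bits `ys` against `xc` from the flag `m₀`: a
differing bit, or a bit with `xc` exhausted, raises it. [folklore] -/
def cmpMis : Bool → List Bool → List Bool → Bool
  | m₀, [], _ => m₀
  | _, _ :: ys, [] => cmpMis true ys []
  | m₀, b :: ys, c :: xc => cmpMis (m₀ || (b != c)) ys xc

/-- A raised flag stays raised. [folklore] -/
theorem cmpMis_true : ∀ (ys xc : List Bool), cmpMis true ys xc = true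
  | [], _ => rfl
  | _ :: ys, [] => cmpMis_true ys []
  | b :: ys, c :: xc => by rw [cmpMis, Bool.true_or]; exact cmpMis_true ys xc

/-- **The comparison decides equality**: no mismatch and `xc` exhausted (`|xc| ≤ |ys|`) iff the
bits read are exactly the query. [folklore] -/
theorem cmpMis_false_iff : ∀ (ys xc : List Bool),
    (cmpMis false ys xc = false ∧ xc.length ≤ ys.length) ↔ ys = xc
  | [], xc => by cases xc <;> simp [cmpMis]
  | b :: ys, [] => by simp [cmpMis, cmpMis_true]
  | b :: ys, c :: xc => by
    rw [cmpMis, Bool.false_or, List.length_cons, List.length_cons, List.cons_eq_cons]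
    by_cases hbc : b = c
    · subst hbc
      have ih := cmpMis_false_iff ys xc
      simp only [bne_self_eq_false, Nat.add_le_add_iff_right, true_and]
      exact ih
    · have : (b != c) = true := by simpa using hbc
      rw [this, cmpMis_true]; simp [hbc]

/-- The value contributed to `ls` by a matching entry with value `v`. [folklore] -/
def lsOf : LMode → Bool → Bool
  | .has, _ => true
  | .val, v => v
  | .flip, _ => false

/-- The value emitted for an entry with value `v` (`mt`: the entry matches). [folklore] -/
def outPol (m : LMode) (v mt : Bool) : Bool := if m = .flip ∧ mt = true then !v else v

/-- The entries after the pass: in mode `flip` the matching entries are negated. [folklore] -/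
def luOut (m : LMode) (x : List Bool) (al : List (List Bool × Bool)) : List (List Bool × Bool) :=
  al.map fun e => (e.1, outPol m e.2 (decide (e.1 = x)))

/-- The flag accumulated by the pass. [folklore] -/
def luFlag (m : LMode) (x : List Bool) (al : List (List Bool × Bool)) : Bool :=
  al.any fun e => decide (e.1 = x) && lsOf m e.2

/-- In mode `flip` the pass computes `flipKey`. [folklore] -/
theorem luOut_flip (x : List Bool) (al : Assg) : luOut .flip x al = flipKey al x := by
  unfold luOut flipKey outPol
  refine List.map_congr_left fun e _ => ?_
  by_cases h : e.1 = x <;> simp [h]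

/-- In the other modes the pass leaves the assignment alone. [folklore] -/
theorem luOut_of_ne_flip {m : LMode} (hm : m ≠ .flip) (x : List Bool) (al : Assg) : luOut m x al = al := by
  unfold luOut outPol
  conv_rhs => rw [← List.map_id al]
  refine List.map_congr_left fun e _ => ?_
  simp [hm]

/-- In mode `val` the flag is `valOf`. [folklore] -/
theorem luFlag_val (x : List Bool) (al : Assg) : luFlag .val x al = valOf al x := rfl

/-- In mode `has` the flag is `hasKey`. [folklore] -/
theorem luFlag_has (x : List Bool) (al : Assg) : luFlag .has x al = hasKey al x := by
  simp [luFlag, hasKey, lsOf]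

/-- `luOut` of a cons. [folklore] -/
@[simp] theorem luOut_cons (m : LMode) (x : List Bool) (e : List Bool × Bool) (al : Assg) :
    luOut m x (e :: al) = (e.1, outPol m e.2 (decide (e.1 = x))) :: luOut m x al := rfl

/-- `luOut` of nil. [folklore] -/
@[simp] theorem luOut_nil (m : LMode) (x : List Bool) : luOut m x [] = [] := rfl

/-- `luFlag` of a cons. [folklore] -/
@[simp] theorem luFlag_cons (m : LMode) (x : List Bool) (e : List Bool × Bool) (al : Assg) :
    luFlag m x (e :: al) = ((decide (e.1 = x) && lsOf m e.2) || luFlag m x al) := rfl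

/-- `luFlag` of nil. [folklore] -/
@[simp] theorem luFlag_nil (m : LMode) (x : List Bool) : luFlag m x [] = false := rfl

/-- In mode `flip` the flag stays down. [folklore] -/
theorem luFlag_flip (x : List Bool) (al : Assg) : luFlag .flip x al = false := by
  induction al with
  | nil => rfl
  | cons e al ih => rw [luFlag_cons, ih]; simp [lsOf]

/-- `luOut` preserves the index lengths (hence code lengths). [folklore] -/
@[simp] theorem length_bits_aToks_luOut (m : LMode) (x : List Bool) (al : Assg) :
    (bits (aToks (luOut m x al))).length = (bits (aToks al)).length := by
  rw [length_bits_aToks, length_bits_aToks, luOut, List.map_map]; rfl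

/-! ### Simulation of the handlers

All simulation lemmas take the initial register file as an explicit update
`{ ρ with … }` of an arbitrary file `ρ` listing every register the routine reads, so that
initial and final files are compared purely structurally. -/

/-- `cmpBit`, in the functional model. [folklore] -/
theorem runs_cmpBit (b m₀ : Bool) (xc : List Bool) (ρ : RF) :
    Runs (cmpBit b) (mk { ρ with xc := xc, mis := flag m₀ })
      (mk { ρ with xc := xc.tail, mis := flag (cmpMis m₀ [b] xc) }) 5 := by
  unfold cmpBit
  cases xc with
  | nil =>
    have h := runs_setFlag R.mis (mk { ρ with xc := [], mis := flag m₀ }) (by cases m₀ <;> simp)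
    refine Runs.pop_nil _ _ (by simp) (h.of_eq ?_ le_rfl)
    simp [cmpMis]
  | cons c xc =>
    cases c
    · refine Runs.pop_false' _ _ (by simp) (update_mk_xc _ xc) ?_
      cases b
      · refine (Runs.skip _).of_eq ?_ (Nat.zero_le 3); simp [cmpMis]
      · have h := runs_setFlag R.mis (mk { ρ with xc := xc, mis := flag m₀ }) (by cases m₀ <;> simp)
        refine h.of_eq ?_ le_rfl; simp [cmpMis]
    · refine Runs.pop_true' _ _ (by simp) (update_mk_xc _ xc) ?_
      cases b
      · have h := runs_setFlag R.mis (mk { ρ with xc := xc, mis := flag m₀ }) (by cases m₀ <;> simp)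
        refine h.of_eq ?_ le_rfl; simp [cmpMis]
      · refine (Runs.skip _).of_eq ?_ (Nat.zero_le 3); simp [cmpMis]

/-- `luBit b` inside an entry (`md` raised): emit, keep `md`, compare; `13` steps. [folklore] -/
theorem runs_luBit_cont (b m₀ : Bool) (xc f2r : List Bool) (ρ : RF) :
    Runs (luBit b) (mk { ρ with md := [true], xc := xc, mis := flag m₀, f2r := f2r })
      (mk { ρ with
            md := [true], xc := xc.tail, mis := flag (cmpMis m₀ [b] xc)
            f2r := (Tok.bit b).code.reverse ++ f2r }) 13 := by
  unfold luBit
  set ρ₀ : RF := { ρ with md := [true], xc := xc, mis := flag m₀, f2r := f2r } with hρ₀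
  have h1 := runs_emit R.f2r (.bit b) (mk ρ₀)
  simp only [update_mk_f2r, mk_f2r] at h1
  set ρ₁ : RF := { ρ₀ with f2r := (Tok.bit b).code.reverse ++ ρ₀.f2r } with hρ₁
  have h2 : Runs (.pop .md (.push .md true) (.push .md true) (copy .x .xc .t .u ;; .push .md true))
      (mk ρ₁) (mk ρ₁) (1 + 2) :=
    Runs.pop_true' _ _ (by simp [hρ₁, hρ₀]) (update_mk_md ρ₁ []) (Runs.push' (by simp [hρ₁, hρ₀]))
  have h3 := runs_cmpBit b m₀ xc { ρ₁ with xc := xc }  -- `mis := flag m₀` is already the case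
  have e3 : ({ { ρ₁ with xc := xc } with xc := xc, mis := flag m₀ } : RF) = ρ₁ := by simp [hρ₁, hρ₀]
  rw [e3] at h3
  exact (h1.seq (h2.seq h3)).of_eq (by simp [hρ₁, hρ₀]) (by omega)

/-- `luBit b` at the start of an entry (`md` down, `xc` empty, scratch empty): emit, load the
query, raise `md`, compare; `10 |x| + 16` steps. [folklore] -/
theorem runs_luBit_start (b m₀ : Bool) (x f2r : List Bool) (ρ : RF) :
    Runs (luBit b) (mk { ρ with md := [], xc := [], mis := flag m₀, t := [], u := [], x := x, f2r := f2r })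
      (mk { ρ with
            md := [true], xc := x.tail, mis := flag (cmpMis m₀ [b] x), t := [], u := [], x := x
            f2r := (Tok.bit b).code.reverse ++ f2r }) (10 * x.length + 16) := by
  unfold luBit
  set ρ₀ : RF := { ρ with md := [], xc := [], mis := flag m₀, t := [], u := [], x := x, f2r := f2r } with hρ₀
  have h1 := runs_emit R.f2r (.bit b) (mk ρ₀)
  simp only [update_mk_f2r, mk_f2r] at h1
  set ρ₁ : RF := { ρ₀ with f2r := (Tok.bit b).code.reverse ++ ρ₀.f2r } with hρ₁
  have hc := runs_copy (a := R.x) (b := R.xc) (t := R.t) (u := R.u) (by decide) (by decide) (by decide)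
    (by decide) (by decide) (by decide) (mk ρ₁) (by simp [hρ₁, hρ₀]) (by simp [hρ₁, hρ₀])
  simp only [mk_x, mk_xc, update_mk_xc] at hc
  have h2 : Runs (.pop .md (.push .md true) (.push .md true) (copy .x .xc .t .u ;; .push .md true))
      (mk ρ₁) (mk { ρ₁ with xc := x, md := [true] }) (10 * x.length + 3 + 1 + 2) := by
    refine (Runs.pop_nil _ _ (by simp [hρ₁, hρ₀]) (hc.seq (Runs.push' rfl))).of_eq ?_ ?_
    · simp [hρ₁, hρ₀]
    · simp [hρ₁, hρ₀]
  have h3 := runs_cmpBit b m₀ x { ρ₁ with xc := x, md := [true] }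
  have e3 : ({ { ρ₁ with xc := x, md := [true] } with xc := x, mis := flag m₀ } : RF) =
      { ρ₁ with xc := x, md := [true] } := by simp [hρ₁, hρ₀]
  rw [e3] at h3
  exact (h1.seq (h2.seq h3)).of_eq (by simp [hρ₁, hρ₀]) (by omega)

/-- Transporting a run along an equality of initial register files (a deliberate dot-notation
extension of `Com.Runs` of `StackPrograms.lean`, the initial-register twin of `Com.Runs.congr`
there). DUPLICATION NOTE for a librarian: the same one-liner already exists twice in the tree —
`Com.Runs.start_eq` (`Computability/Cryptography/WordRAMToTM2Ruler.lean`) and the four-argument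
`Com.Runs.of_eq'` (`Algebra/EuclideanLattices/GapCVPPrimeMachine.lean`) — neither importable here
without dragging an unrelated development into the fine-grained files; the right home of all
three is `StackPrograms.lean` next to `Runs.congr`, after which the copies (this one included)
should be retired. [folklore] -/
theorem _root_.Literature.Computability.Complexity.Com.Runs.of_eq_init {ι : Type} [DecidableEq ι]
    {c : Com ι} {Rg R₀ R' : Regs ι} {B : ℕ} (h : Runs c Rg R' B) (e : Rg = R₀) :
    Runs c R₀ R' B := e ▸ h

/-- One more comparison step in the functional model. [folklore] -/
theorem cmpMis_cons_eq (m₀ b : Bool) (ys xc : List Bool) :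
    cmpMis (cmpMis m₀ [b] xc) ys xc.tail = cmpMis m₀ (b :: ys) xc := by
  cases xc <;> rfl

/-- **The bits of an entry after the first** (continuation-passing form): from `md` raised,
`xc`, `mis = flag m₀`, `f2 = code (ys.map bit) ++ rest`, the loop reads the bits — leaving
`xc.drop |ys|`, `flag (cmpMis m₀ ys xc)`, the bits re-emitted on `f2r` — and continues;
`23` steps per bit. [folklore] -/
theorem runs_luBits_cont (m : LMode) : ∀ (ys : List Bool) (m₀ : Bool) (xc f2r rest : List Bool) (ρ : RF)
    {R₂ : Regs R} {B₂ : ℕ},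
    Runs (tokLoop .f2 (luH m))
      (mk { ρ with
            md := [true], xc := xc.drop ys.length, mis := flag (cmpMis m₀ ys xc)
            f2r := (bits (ys.map Tok.bit)).reverse ++ f2r, f2 := rest }) R₂ B₂ →
    Runs (tokLoop .f2 (luH m))
      (mk { ρ with md := [true], xc := xc, mis := flag m₀, f2r := f2r, f2 := bits (ys.map Tok.bit) ++ rest })
      R₂ (23 * ys.length + B₂)
  | [], m₀, xc, f2r, rest, ρ, R₂, B₂, hcont => by
    refine (hcont.of_eq_init ?_).mono (by simp)
    simp [cmpMis]
  | b :: ys, m₀, xc, f2r, rest, ρ, R₂, B₂, hcont => by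
    have h1 := runs_luBit_cont b m₀ xc f2r { ρ with f2 := bits (ys.map Tok.bit) ++ rest }
    have h2 := runs_luBits_cont m ys (cmpMis m₀ [b] xc) (xc.tail) ((Tok.bit b).code.reverse ++ f2r) rest ρ
      (R₂ := R₂) (B₂ := B₂) (hcont.of_eq_init (by
        simp [cmpMis_cons_eq, List.reverse_append]))
    have h := runs_tokLoop_cons (k := R.f2) (H := luH m) (t := .bit b)
      (rest := bits (ys.map Tok.bit) ++ rest)
      (Rg := mk { ρ with md := [true], xc := xc, mis := flag m₀, f2r := f2r,
                         f2 := bits ((b :: ys).map Tok.bit) ++ rest })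
      (by simp) (by rw [luH_run]; simpa using h1) (h2.of_eq_init (by simp))
    exact h.of_eq rfl (by simp; omega)

/-! ### The end of an entry -/

/-- What a matching entry does: emit (negated in mode `flip`), raise `ls` per mode; from
`ls = flag s`, within `8` steps. [folklore] -/
theorem runs_onMatch (m : LMode) (v s : Bool) (f2r : List Bool) (ρ : RF) :
    Runs (onMatch m v) (mk { ρ with ls := flag s, f2r := f2r })
      (mk { ρ with ls := flag (s || lsOf m v), f2r := (Tok.pol (outPol m v true)).code.reverse ++ f2r }) 8 := by
  set ρ₀ : RF := { ρ with ls := flag s, f2r := f2r } with hρ₀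
  cases m with
  | has =>
    unfold onMatch
    have h1 := runs_emit R.f2r (.pol v) (mk ρ₀)
    simp only [update_mk_f2r, mk_f2r] at h1
    have h2 := runs_setFlag R.ls (mk { ρ₀ with f2r := (Tok.pol v).code.reverse ++ ρ₀.f2r })
      (by cases s <;> simp [hρ₀])
    exact (h1.seq h2).of_eq (by simp [hρ₀, outPol, lsOf]) (by omega)
  | val =>
    unfold onMatch
    have h1 := runs_emit R.f2r (.pol v) (mk ρ₀)
    simp only [update_mk_f2r, mk_f2r] at h1
    cases v
    · exact (h1.seq (Runs.skip _)).of_eq (by simp [hρ₀, outPol, lsOf]) (by omega)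
    · have h2 := runs_setFlag R.ls (mk { ρ₀ with f2r := (Tok.pol true).code.reverse ++ ρ₀.f2r })
        (by cases s <;> simp [hρ₀])
      exact (h1.seq h2).of_eq (by simp [hρ₀, outPol, lsOf]) (by omega)
  | flip =>
    unfold onMatch
    have h1 := runs_emit R.f2r (.pol (!v)) (mk ρ₀)
    simp only [update_mk_f2r, mk_f2r] at h1
    exact h1.of_eq (by simp [hρ₀, outPol, lsOf]) (by omega)

/-- The match test of `luPol` (its last two instructions), from `xc = xc₁`, `mis = flag m₁`,
`ls = flag s`: the entry matches iff `xc₁ = []` and `m₁ = false`; within `2 |xc₁| + 18` steps.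
[folklore] -/
theorem runs_luPol_test (m : LMode) (v s m₁ : Bool) (xc₁ f2r : List Bool) (ρ : RF) :
    Runs (.pop .xc (setFlag .mis ;; clear .xc) (setFlag .mis ;; clear .xc) .skip ;;
          .pop .mis (emit .f2r (.pol v)) (emit .f2r (.pol v)) (onMatch m v))
      (mk { ρ with xc := xc₁, mis := flag m₁, ls := flag s, f2r := f2r })
      (mk { ρ with
            xc := [], mis := []
            ls := flag (s || (decide (xc₁ = [] ∧ m₁ = false) && lsOf m v))
            f2r := (Tok.pol (outPol m v (decide (xc₁ = [] ∧ m₁ = false)))).code.reverse ++ f2r })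
      (2 * xc₁.length + 18) := by
  set mt : Bool := decide (xc₁ = [] ∧ m₁ = false) with hmt
  set ρ₀ : RF := { ρ with xc := xc₁, mis := flag m₁, ls := flag s, f2r := f2r } with hρ₀
  -- after the first instruction: `xc = []`, `mis = flag (!mt)`
  have h1 : Runs (.pop .xc (setFlag .mis ;; clear .xc) (setFlag .mis ;; clear .xc) .skip) (mk ρ₀)
      (mk { ρ₀ with xc := [], mis := flag (!mt) }) (2 * xc₁.length + 8) := by
    cases xc₁ with
    | nil =>
      refine (Runs.pop_nil _ _ (by simp [hρ₀]) (Runs.skip _)).of_eq ?_ (by omega)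
      cases m₁ <;> simp [hρ₀, hmt]
    | cons c xc =>
      have hs : ∀ b' : Bool, Runs (setFlag .mis ;; clear .xc) (mk { ρ₀ with xc := xc })
          (mk { ρ₀ with xc := [], mis := [true] }) (3 + (2 * xc.length + 1)) := by
        intro _
        have a := runs_setFlag R.mis (mk { ρ₀ with xc := xc }) (by cases m₁ <;> simp [hρ₀])
        have b := runs_clear R.xc (Function.update (mk { ρ₀ with xc := xc }) R.mis [true])
        refine (a.seq b).of_eq ?_ ?_
        · simp [hρ₀]
        · simp [hρ₀]
      have hne : mt = false := by simp [hmt]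
      cases c
      · refine (Runs.pop_false' _ _ (by simp [hρ₀]) (update_mk_xc ρ₀ xc) (hs true)).of_eq ?_ (by simp; omega)
        simp [hne]
      · refine (Runs.pop_true' _ _ (by simp [hρ₀]) (update_mk_xc ρ₀ xc) (hs true)).of_eq ?_ (by simp; omega)
        simp [hne]
  set ρ₁ : RF := { ρ₀ with xc := [], mis := flag (!mt) } with hρ₁
  have h2 : Runs (.pop .mis (emit .f2r (.pol v)) (emit .f2r (.pol v)) (onMatch m v)) (mk ρ₁)
      (mk { ρ₁ with
            mis := [], ls := flag (s || (mt && lsOf m v))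
            f2r := (Tok.pol (outPol m v mt)).code.reverse ++ f2r }) 10 := by
    cases hm : mt
    · -- no match: `mis` holds `true`, is popped, the entry is emitted unchanged
      have e := runs_emit R.f2r (.pol v) (Function.update (mk ρ₁) R.mis [])
      refine (Runs.pop_true' _ _ (by simp [hρ₁, hm]) rfl e).of_eq ?_ (by omega)
      simp [hρ₁, hρ₀, outPol]
    · have e := runs_onMatch m v s f2r { ρ₁ with mis := [] }
      refine (Runs.pop_nil _ _ (by simp [hρ₁, hm]) (e.of_eq_init ?_)).of_eq ?_ (by omega)
      · simp [hρ₁, hρ₀, hm]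
      · simp [hρ₁, hρ₀]
  exact (h1.seq h2).of_eq (by simp [hρ₁, hρ₀]) (by omega)

/-- **`luPol` at the end of an entry whose bits `ys` have been read**, from the state the
bits leave: `md = [true]`, `xc = x.drop |ys|`, `mis = flag (cmpMis false ys x)` when
`ys ≠ []`, and the entry-start state `md = []`, `xc = []`, `mis = []` when `ys = []` — both are
`{ md := mdOf ys, xc := x.drop |ys|, mis := flag (cmpMis false ys x) }` with
`mdOf ys = [ys ≠ []]`. The entry matches iff `ys = x`; within `12 |x| + 23` steps. [folklore] -/
theorem runs_luPol (m : LMode) (v s : Bool) (ys x f2r : List Bool) (ρ : RF) :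
    Runs (luPol m v)
      (mk { ρ with
            md := (if ys = [] then [] else [true]), xc := (if ys = [] then [] else x.drop ys.length)
            mis := flag (cmpMis false ys x), ls := flag s, t := [], u := [], x := x, f2r := f2r })
      (mk { ρ with
            md := [], xc := [], mis := [], t := [], u := [], x := x
            ls := flag (s || (decide (ys = x) && lsOf m v))
            f2r := (Tok.pol (outPol m v (decide (ys = x)))).code.reverse ++ f2r }) (12 * x.length + 23) := by
  unfold luPol
  set ρ₀ : RF := { ρ with
    md := (if ys = [] then [] else [true]), xc := (if ys = [] then [] else x.drop ys.length)
    mis := flag (cmpMis false ys x), ls := flag s, t := [], u := [], x := x, f2r := f2r } with hρ₀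
  -- the first instruction brings both situations to `md = []`, `xc = x.drop |ys|`
  have h1 : Runs (.pop .md .skip .skip (copy .x .xc .t .u)) (mk ρ₀) (mk { ρ₀ with md := [], xc := x.drop ys.length })
      (10 * x.length + 5) := by
    by_cases hys : ys = []
    · subst hys
      have hc := runs_copy (a := R.x) (b := R.xc) (t := R.t) (u := R.u) (by decide) (by decide) (by decide)
        (by decide) (by decide) (by decide) (mk ρ₀) (by simp [hρ₀]) (by simp [hρ₀])
      refine (Runs.pop_nil _ _ (by simp [hρ₀]) hc).of_eq ?_ (by simp [hρ₀])
      simp [hρ₀, cmpMis]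
    · refine (Runs.pop_true' _ _ (by simp [hρ₀, hys]) (update_mk_md ρ₀ []) (Runs.skip _)).of_eq ?_ (by omega)
      simp [hρ₀, hys]
  have h2 := runs_luPol_test m v s (cmpMis false ys x) (x.drop ys.length) f2r { ρ₀ with md := [], xc := x.drop ys.length }
  have hmt : decide (x.drop ys.length = [] ∧ cmpMis false ys x = false) = decide (ys = x) := by
    rw [decide_eq_decide, List.drop_eq_nil_iff, and_comm]
    exact cmpMis_false_iff ys x
  refine (h1.seq (h2.of_eq_init ?_)).of_eq ?_ ?_
  · simp [hρ₀]
  · simp only [hmt]; simp [hρ₀]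
  · have : (x.drop ys.length).length ≤ x.length := by simp
    omega

/-! ### One entry, a whole assignment -/

/-- **One entry** (continuation-passing form): from the entry-start state (`md`, `xc`, `mis`,
`t`, `u` down, `ls = flag s`) with `f2 = code (eToks e) ++ rest`, the loop processes the entry
— re-emitting it on `f2r` (negated in mode `flip` if it matches), updating `ls` — and
continues; `23 (|x| + |e.1| + 3)` steps for the entry. [folklore] -/
theorem runs_luEntry (m : LMode) (e : List Bool × Bool) (s : Bool) (x f2r rest : List Bool) (ρ : RF)
    {R₂ : Regs R} {B₂ : ℕ}
    (hcont : Runs (tokLoop .f2 (luH m))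
      (mk { ρ with
            md := [], xc := [], mis := [], t := [], u := [], x := x
            ls := flag (s || (decide (e.1 = x) && lsOf m e.2))
            f2r := (bits (eToks (e.1, outPol m e.2 (decide (e.1 = x))))).reverse ++ f2r
            f2 := rest }) R₂ B₂) :
    Runs (tokLoop .f2 (luH m))
      (mk { ρ with
            md := [], xc := [], mis := [], t := [], u := [], x := x, ls := flag s, f2r := f2r
            f2 := bits (eToks e) ++ rest }) R₂ (23 * (x.length + e.1.length + 3) + B₂) := by
  obtain ⟨ys, v⟩ := e
  simp only [eToks, bits_append, bits_cons, bits_nil, List.append_nil, List.reverse_append,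
    List.append_assoc] at hcont ⊢
  -- the closing `pol v`, from the state the bits leave
  have hpol : Runs (tokLoop .f2 (luH m))
      (mk { ρ with
            md := (if ys = [] then [] else [true]), xc := (if ys = [] then [] else x.drop ys.length)
            mis := flag (cmpMis false ys x), ls := flag s, t := [], u := [], x := x
            f2r := (bits (ys.map Tok.bit)).reverse ++ f2r, f2 := (Tok.pol v).code ++ rest })
      R₂ (12 * x.length + 23 + 10 + B₂) := by
    have h1 := runs_luPol m v s ys x ((bits (ys.map Tok.bit)).reverse ++ f2r)
      { ρ with f2 := rest }
    refine runs_tokLoop_cons (t := .pol v) (rest := rest) (by simp) (by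
      rw [luH_run]; exact h1.of_eq_init (by simp)) (hcont.of_eq_init ?_)
    simp
  cases ys with
  | nil =>
    refine (hpol.of_eq_init ?_).mono (by simp; omega)
    simp [cmpMis]
  | cons b ys =>
    -- the first bit loads the query, the others follow, then `pol v`
    have h1 := runs_luBit_start b false x f2r
      { ρ with ls := flag s, f2 := bits (ys.map Tok.bit) ++ ((Tok.pol v).code ++ rest) }
    have h2 := runs_luBits_cont m ys (cmpMis false [b] x) (x.tail) ((Tok.bit b).code.reverse ++ f2r)
      ((Tok.pol v).code ++ rest) { ρ with ls := flag s, t := [], u := [], x := x } (R₂ := R₂)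
      (B₂ := 12 * x.length + 23 + 10 + B₂) (hpol.of_eq_init (by
        simp [cmpMis_cons_eq, List.reverse_append]))
    have h := runs_tokLoop_cons (k := R.f2) (H := luH m) (t := .bit b)
      (rest := bits (ys.map Tok.bit) ++ ((Tok.pol v).code ++ rest))
      (Rg := mk { ρ with
        md := [], xc := [], mis := [], t := [], u := [], x := x, ls := flag s, f2r := f2r
        f2 := (Tok.bit b).code ++ (bits (List.map Tok.bit ys) ++ ((Tok.pol v).code ++ rest)) })
      (by simp) (by rw [luH_run]; exact h1.of_eq_init (by simp)) (h2.of_eq_init (by simp))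
    refine (h.of_eq_init ?_).of_eq rfl ?_
    · simp
    · simp; ring_nf; omega

/-- **A whole assignment** (continuation-passing form): the loop processes the entries of
`al` one by one — `f2r` receives the code of `luOut m x al` reversed, `ls` becomes
`flag (s || luFlag m x al)` — and continues; `23 (|x| + 4) |code al|` steps. [folklore] -/
theorem runs_luAssg (m : LMode) : ∀ (al : Assg) (s : Bool) (x f2r rest : List Bool) (ρ : RF)
    {R₂ : Regs R} {B₂ : ℕ},
    Runs (tokLoop .f2 (luH m))
      (mk { ρ with
            md := [], xc := [], mis := [], t := [], u := [], x := x
            ls := flag (s || luFlag m x al)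
            f2r := (bits (aToks (luOut m x al))).reverse ++ f2r, f2 := rest }) R₂ B₂ →
    Runs (tokLoop .f2 (luH m))
      (mk { ρ with
            md := [], xc := [], mis := [], t := [], u := [], x := x, ls := flag s, f2r := f2r
            f2 := bits (aToks al) ++ rest }) R₂ (23 * (x.length + 4) * (bits (aToks al)).length + B₂)
  | [], s, x, f2r, rest, ρ, R₂, B₂, hcont => by
    refine (hcont.of_eq_init ?_).mono (by simp)
    simp
  | e :: al, s, x, f2r, rest, ρ, R₂, B₂, hcont => by
    have h2 := runs_luAssg m al (s || (decide (e.1 = x) && lsOf m e.2)) x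
      ((bits (eToks (e.1, outPol m e.2 (decide (e.1 = x))))).reverse ++ f2r) rest ρ (R₂ := R₂) (B₂ := B₂)
      (hcont.of_eq_init (by simp [List.reverse_append, Bool.or_assoc]))
    have h1 := runs_luEntry m e s x f2r (bits (aToks al) ++ rest) ρ h2
    refine (h1.of_eq_init (by simp)).mono ?_
    simp only [aToks_cons, bits_append, List.length_append, length_bits_eToks]
    nlinarith [Nat.zero_le x.length, Nat.zero_le e.1.length, Nat.zero_le (bits (aToks al)).length]

/-- **The assignment pass** `lookup m` on `f2 = code al` from the rest state (`f2r`, `md`,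
`xc`, `mis`, `t`, `u` empty, `ls = flag s`): `f2` ends holding the code of `luOut m x al`
(`flipKey al x` in mode `flip`, `al` otherwise) and `ls` holds `flag (s || luFlag m x al)`
(`hasKey` / `valOf` in modes `has` / `val`); within `(23 |x| + 95) |code al| + 2` steps.
[folklore] -/
theorem runs_lookup (m : LMode) (al : Assg) (s : Bool) (x : List Bool) (ρ : RF) :
    Runs (lookup m)
      (mk { ρ with md := [], xc := [], mis := [], t := [], u := [], x := x, ls := flag s, f2r := [],
                   f2 := bits (aToks al) })
      (mk { ρ with md := [], xc := [], mis := [], t := [], u := [], x := x, f2r := [],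
                   ls := flag (s || luFlag m x al), f2 := bits (aToks (luOut m x al)) })
      ((23 * x.length + 95) * (bits (aToks al)).length + 2) := by
  unfold lookup
  set ρ₁ : RF := { ρ with
    md := [], xc := [], mis := [], t := [], u := [], x := x, ls := flag (s || luFlag m x al)
    f2r := (bits (aToks (luOut m x al))).reverse ++ [], f2 := [] } with hρ₁
  have h1 := runs_luAssg m al s x [] [] ρ (R₂ := mk ρ₁) (B₂ := 1) (runs_tokLoop_nil (by simp))
  have h2 := runs_pour (a := R.f2r) (b := R.f2) (by decide) (mk ρ₁)
  refine ((h1.of_eq_init (by simp)).seq h2).of_eq ?_ ?_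
  · simp [hρ₁]
  · simp only [hρ₁, mk_f2r, List.append_nil, List.length_reverse, length_bits_aToks_luOut]
    nlinarith [Nat.zero_le x.length, Nat.zero_le (bits (aToks al)).length]

end Literature.Computability.FineGrained.Schoening
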